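import Summits.ABC.StewartYu.PadicW80Par3D
import Summits.ABC.StewartYu.PadicW80ParLD
import Literature.NumberTheory.Transcendental.Waldschmidt1980Count
import HarnessLib

/-!
# The `q = 3` (`p = 2`) parameter record — part E: the count of Siegel's step (Lemma 3.2) at base 3

Support file (theorems only; no named facts), cell `abc-stewartyu` (p1; crux `W80Two` stmt-ABC-19486; design memo
HOME/p1/S2-q3-record-design.md).  Base-`3` twin of `PadicW80ParLF.padic_siegel_count_real`: for any frame
`S : CW77.Setup` at the record `P : PadicW80ParL S.d`, twice `Mcl` times `S₀ · #tauSet(d, T)` (an UPPER bound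
for the number `#Pts3(S₀)·#tauSet` of equations of level `0`, `#Pts3(S₀) = 2S₀/3 ≤ S₀`) is at most the number of
unknowns `h L_b ∏ᵢ (Lall3ᵢ + 1) = #box3₀`; the slack is `(A c_T/(9 c_L' c_S))^m ≈ 2^{30m}`.  Also `Lall3` simp
lemmas.  Everything is [folklore] bookkeeping on [cite: Waldschmidt1980, Lemma 3.2 and (3.6) (pp. 264–267)].
-/

noncomputable section

open Finset Real
open Literature.NumberTheory.Transcendental Literature.NumberTheory.Transcendental.Waldschmidt1980

namespace Summit.ABC.StewartYu

open PadicW80Par (cTp cSp cLp cLp' Ap mRp)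

namespace PadicW80ParL

open Literature.NumberTheory.Transcendental.CW77 Literature.NumberTheory.Transcendental.CW77.Setup

section Lall

variable {d : ℕ} (P : PadicW80ParL d)

/-- `Lall3 (castSucc j) = L3 j`. [folklore] -/
@[simp] theorem Lall3_castSucc (j : Fin d) : P.Lall3 (Fin.castSucc j) = P.L3 j := by
  unfold Lall3; rw [Fin.snoc_castSucc]

/-- `Lall3 last = Lθ3`. [folklore] -/
@[simp] theorem Lall3_last : P.Lall3 (Fin.last d) = P.Lθ3 := by
  unfold Lall3; rw [Fin.snoc_last]

end Lall

/-- **The count of Lemma 3.2 at the `2`-adic parameters with the class price `Mcl`**: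
`2 · Mcl · S₀ · #tauSet(d, T) ≤ h L_b ∏ᵢ (Lall3ᵢ + 1)` — with the factorial of `#tauSet ≤ (T+d)^{d+1}/(d+1)!`
against the `m^{2m+1}/m!` of `U`. [cite: Waldschmidt1980, Lemma 3.2 and (3.6) (pp. 264–267)] -/
theorem padic_siegel_count3_real (S : CW77.Setup) (P : PadicW80ParL S.d) :
    2 * P.Mcl * ((P.S₀3 : ℝ) * ((tauSet S.d P.T3).card : ℝ)) ≤ P.hparℓ * P.Lb3 * ∏ i, ((P.Lall3 i : ℝ) + 1) := by
  -- notation and basic facts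
  have hMcl := P.hMcl; have hℓ := P.ℓ_pos
  have hm0 := mR_pos P; have hm2 := two_le_mR P
  have hW := P.one_le_Wstar; have hG := P.G_pos; have hU := P.U_pos; have h𝔘 := P.𝔘3_pos
  have hS := P.S₀3_pos; have hT := P.T3_pos
  have em : ((S.d + 1 : ℕ) : ℝ) = mRp S.d := by unfold mRp; push_cast; ring
  -- (1) the count of `τ`
  have h1 : ((tauSet S.d P.T3).card : ℝ) ≤ (2 * (P.T3 : ℝ)) ^ (S.d + 1) / (S.d + 1).factorial := by
    have h := Waldschmidt1980.card_tauSet_le_pow_div_factorial S.d P.T3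
    have hTd : (P.T3 : ℝ) + S.d ≤ 2 * P.T3 := by
      have h2 := P.T3_ge_Lθ3
      have hL : (1 : ℝ) ≤ P.Lθ3 := by exact_mod_cast P.one_le_Lθ3
      have hV := P.one_le_nVθ
      have hd : (S.d : ℝ) ≤ mRp S.d := by unfold mRp; linarith
      have : (S.d : ℝ) ≤ 2 ^ 11 * mRp S.d ^ 2 * P.nVθ * P.Lθ3 := by
        have h3 : mRp S.d ≤ 2 ^ 11 * mRp S.d ^ 2 * P.nVθ * P.Lθ3 := by
          calc mRp S.d = 1 * (mRp S.d * 1) * 1 * 1 := by ring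
            _ ≤ 2 ^ 11 * (mRp S.d * mRp S.d) * P.nVθ * P.Lθ3 := by gcongr <;> linarith
            _ = 2 ^ 11 * mRp S.d ^ 2 * P.nVθ * P.Lθ3 := by ring
        linarith
      linarith
    calc ((tauSet S.d P.T3).card : ℝ) ≤ ((P.T3 : ℝ) + S.d) ^ (S.d + 1) / (S.d + 1).factorial := h
      _ ≤ (2 * (P.T3 : ℝ)) ^ (S.d + 1) / (S.d + 1).factorial := by gcongr
  -- (2) `T ≤ 𝔘/(c_T W⋆)`
  have h2 : (P.T3 : ℝ) ≤ P.𝔘3 / (cTp * P.Wstarℓ) := by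
    have := P.T3_le
    rw [P.U_eq3] at this
    have e : 3 ^ (S.d + 1) * P.𝔘3 / (cTp * 3 ^ (S.d + 1) * P.Wstarℓ) = P.𝔘3 / (cTp * P.Wstarℓ) := by
      unfold cTp; field_simp
    rw [← e]; exact this
  -- (3) the lower bounds for the unknowns
  have h3 : P.𝔘3 / (cLp * P.Gℓ) ≤ (P.hparℓ : ℝ) * P.Lb3 := by
    have hh := P.hpar_pos
    have hLb : P.Uℓ / (cLp * 3 ^ (S.d + 1) * P.Gℓ * P.hparℓ) ≤ (P.Lb3 : ℝ) := by
      unfold PadicW80ParL.Lb3; push_cast; exact (Nat.lt_floor_add_one _).le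
    have e : P.Uℓ / (cLp * 3 ^ (S.d + 1) * P.Gℓ * P.hparℓ) = P.𝔘3 / (cLp * P.Gℓ) / P.hparℓ := by
      rw [P.U_eq3]; unfold cLp; field_simp
    rw [e, div_le_iff₀ hh] at hLb
    linarith
  have h4 : ∀ i, P.Uℓ / (cLp' * mRp S.d * 3 ^ (S.d + 2) * P.S₀3 * P.Vallℓ i) ≤ (P.Lall3 i : ℝ) + 1 := by
    intro i
    refine Fin.lastCases ?_ (fun j => ?_) i
    · rw [P.Lall3_last, P.Vall_last]; unfold PadicW80ParL.Lθ3; exact (Nat.lt_floor_add_one _).le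
    · rw [P.Lall3_castSucc, P.Vall_castSucc]; unfold PadicW80ParL.L3; exact (Nat.lt_floor_add_one _).le
  set D : ℝ := cLp' * mRp S.d * 3 ^ (S.d + 2) * P.S₀3 with hD
  have hD0 : 0 < D := by rw [hD]; unfold cLp'; positivity
  have h5 : P.Uℓ ^ (S.d + 1) / (D ^ (S.d + 1) * ∏ i, P.Vallℓ i) ≤ ∏ i, ((P.Lall3 i : ℝ) + 1) := by
    have e : P.Uℓ ^ (S.d + 1) / (D ^ (S.d + 1) * ∏ i, P.Vallℓ i) = ∏ i, (P.Uℓ / (D * P.Vallℓ i)) := by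
      rw [prod_div_distrib, prod_const, card_univ, Fintype.card_fin, prod_mul_distrib, prod_const, card_univ,
        Fintype.card_fin]
    rw [e]
    refine prod_le_prod (fun i _ => by have := P.Vall_pos i; positivity) fun i _ => ?_
    have := h4 i
    rwa [show cLp' * mRp S.d * 3 ^ (S.d + 2) * (P.S₀3 : ℝ) * P.Vallℓ i = D * P.Vallℓ i by rw [hD]] at this
  -- (4) the numerical heart: `2 Mcl S₀ (2𝔘/(c_T W⋆))^m/m! ≤ (𝔘/(c_L G)) · U^m/(D^m ∏Vall)`
  have hVall : 0 < ∏ i, P.Vallℓ i := prod_pos fun i _ => P.Vall_pos i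
  have hfac : (0 : ℝ) < (S.d + 1).factorial := by exact_mod_cast Nat.factorial_pos _
  set A₁ : ℝ := 2 * P.Mcl * P.S₀3 * (2 * P.𝔘3) ^ (S.d + 1) with hA₁
  set B₁ : ℝ := (cTp * P.Wstarℓ) ^ (S.d + 1) * (S.d + 1).factorial with hB₁
  set A₂ : ℝ := P.𝔘3 * P.Uℓ ^ (S.d + 1) with hA₂
  set B₂ : ℝ := cLp * P.Gℓ * (D ^ (S.d + 1) * ∏ i, P.Vallℓ i) with hB₂
  have hB₁0 : 0 < B₁ := by rw [hB₁]; unfold cTp; positivity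
  have hB₂0 : 0 < B₂ := by rw [hB₂]; unfold cLp; positivity
  have eL : 2 * P.Mcl * ((P.S₀3 : ℝ) * ((2 * (P.𝔘3 / (cTp * P.Wstarℓ))) ^ (S.d + 1) / (S.d + 1).factorial)) = A₁ / B₁ := by
    rw [hA₁, hB₁, show (2 : ℝ) * (P.𝔘3 / (cTp * P.Wstarℓ)) = (2 * P.𝔘3) / (cTp * P.Wstarℓ) by ring, div_pow]
    field_simp
  have eR : (P.𝔘3 / (cLp * P.Gℓ)) * (P.Uℓ ^ (S.d + 1) / (D ^ (S.d + 1) * ∏ i, P.Vallℓ i)) = A₂ / B₂ := by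
    rw [hA₂, hB₂, div_mul_div_comm]
  have heart : A₁ / B₁ ≤ A₂ / B₂ := by
    rw [div_le_div_iff₀ hB₁0 hB₂0, hA₁, hB₁, hA₂, hB₂]
    -- `2 Mcl S₀ (2𝔘)^m · c_L G D^m ∏Vall ≤ 𝔘 U^m · (c_T W⋆)^m m!`
    rw [P.U_eq3]
    have hprodV : (∏ i, P.Vallℓ i) = (∏ j, P.V j) * P.Vθ := by rw [Fin.prod_univ_castSucc]; simp
    have hprodn : (∏ j, P.V j) * P.Vθ = P.ℓ ^ (S.d + 1) * ((∏ j, P.nV j) * P.nVθ) := by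
      rw [prod_congr rfl fun j _ => P.V_eq j, prod_mul_distrib, prod_const, card_univ, Fintype.card_fin, P.Vθ_eq]
      ring
    have h𝔘eq : P.𝔘3 * ((S.d + 1).factorial : ℝ) * 3 ^ (S.d + 1) =
        P.Mcl * PadicW80Par.Ap ^ (S.d + 1) * mRp S.d ^ (2 * S.d + 3) * ((∏ j, P.nV j) * P.nVθ) * P.Wstarℓ * P.nGℓ := by
      unfold PadicW80ParL.𝔘3 PadicW80ParL.Uℓ; field_simp
    have hS₀ := P.S₀3_le
    have hS0' : (0 : ℝ) ≤ P.S₀3 := hS.le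
    have hnW := P.one_le_nWstar
    have LHS_le : 2 * P.Mcl * (P.S₀3 : ℝ) * (2 * P.𝔘3) ^ (S.d + 1) * (cLp * P.Gℓ * (D ^ (S.d + 1) * ∏ i, P.Vallℓ i)) ≤
        2 * P.Mcl * (3 * (cSp * mRp S.d * P.nWstarℓ)) * (2 * P.𝔘3) ^ (S.d + 1) *
          (cLp * P.Gℓ * ((cLp' * mRp S.d * 3 ^ (S.d + 2) * (3 * (cSp * mRp S.d * P.nWstarℓ))) ^ (S.d + 1) * ∏ i, P.Vallℓ i)) := by
      have hDle : D ≤ cLp' * mRp S.d * 3 ^ (S.d + 2) * (3 * (cSp * mRp S.d * P.nWstarℓ)) := by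
        rw [hD]; unfold cLp'; gcongr
      have hcS : (0 : ℝ) < cSp := by unfold cSp; norm_num
      have hcL : (0 : ℝ) < cLp := by unfold cLp; norm_num
      have h0 : (0 : ℝ) ≤ 2 * P.Mcl * (3 * (cSp * mRp S.d * P.nWstarℓ)) * (2 * P.𝔘3) ^ (S.d + 1) := by positivity
      gcongr
    refine LHS_le.trans ?_
    have e3 : ((3 : ℝ) ^ (S.d + 1)) ^ (S.d + 1) = (3 ^ (S.d + 1)) ^ S.d * 3 ^ (S.d + 1) := pow_succ _ _
    have eRR : P.𝔘3 * (3 ^ (S.d + 1) * P.𝔘3) ^ (S.d + 1) * ((cTp * P.Wstarℓ) ^ (S.d + 1) * (S.d + 1).factorial) =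
        (P.𝔘3 * ((S.d + 1).factorial : ℝ) * 3 ^ (S.d + 1)) * (3 ^ (S.d + 1)) ^ S.d * P.𝔘3 ^ (S.d + 1) * cTp ^ (S.d + 1) *
          P.Wstarℓ ^ (S.d + 1) := by
      rw [mul_pow, mul_pow, e3]; ring
    rw [eRR, h𝔘eq, hprodV, hprodn, P.Wstar_eq, P.G_eq]
    unfold cSp cLp cLp' cTp
    -- both sides are a constant times `M`
    set M : ℝ := P.Mcl * mRp S.d ^ (2 * S.d + 3) * ((∏ j, P.nV j) * P.nVθ) * P.nGℓ * P.𝔘3 ^ (S.d + 1) *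
      P.nWstarℓ ^ (S.d + 2) * P.ℓ ^ (S.d + 2) with hM
    have key : (2 : ℝ) * P.Mcl * (3 * (2 ^ 15 * mRp S.d * P.nWstarℓ)) * (2 * P.𝔘3) ^ (S.d + 1) *
        (2 ^ 14 * (P.ℓ * P.nGℓ) * ((2 ^ 12 * mRp S.d * 3 ^ (S.d + 2) * (3 * (2 ^ 15 * mRp S.d * P.nWstarℓ))) ^ (S.d + 1) *
          (P.ℓ ^ (S.d + 1) * ((∏ j, P.nV j) * P.nVθ))))
        = ((2 : ℝ) ^ 1 * 3 * 2 ^ 15 * 2 ^ 14 * 2 ^ (S.d + 1) * (2 ^ 12 * 3 ^ (S.d + 2) * 3 * 2 ^ 15) ^ (S.d + 1)) * M := by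
      rw [hM]
      have e1 : mRp S.d ^ (2 * S.d + 3) = mRp S.d * (mRp S.d * mRp S.d) ^ (S.d + 1) := by ring
      have e2 : P.nWstarℓ ^ (S.d + 2) = P.nWstarℓ * P.nWstarℓ ^ (S.d + 1) := by ring
      have e4 : P.ℓ ^ (S.d + 2) = P.ℓ * P.ℓ ^ (S.d + 1) := by ring
      rw [e1, e2, e4]; ring
    rw [key]
    have key2 : P.Mcl * PadicW80Par.Ap ^ (S.d + 1) * mRp S.d ^ (2 * S.d + 3) * ((∏ j, P.nV j) * P.nVθ) *
        (P.ℓ * P.nWstarℓ) * P.nGℓ * (3 ^ (S.d + 1)) ^ S.d * P.𝔘3 ^ (S.d + 1) * (2 ^ 14) ^ (S.d + 1) *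
        (P.ℓ * P.nWstarℓ) ^ (S.d + 1)
        = (PadicW80Par.Ap ^ (S.d + 1) * ((3 : ℝ) ^ (S.d + 1)) ^ S.d * (2 ^ 14) ^ (S.d + 1)) * M := by
      rw [hM]
      have e2 : P.nWstarℓ ^ (S.d + 2) = P.nWstarℓ * P.nWstarℓ ^ (S.d + 1) := by ring
      have e4 : P.ℓ ^ (S.d + 2) = P.ℓ * P.ℓ ^ (S.d + 1) := by ring
      rw [e2, e4, mul_pow]; ring
    rw [key2]
    have hnV0 : 0 ≤ (∏ j, P.nV j) * P.nVθ := le_trans zero_le_one P.one_le_prodnVVθ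
    have hM0 : 0 ≤ M := by rw [hM]; have := P.nG_pos; positivity
    refine mul_le_mul_of_nonneg_right ?_ hM0
    -- constants: `2^{31+d} · 3 · (2^{27} · 3^{d+3})^{d+1} ≤ 2^{50(d+1)} · (3^{d+1})^d · 2^{14(d+1)}`:
    -- the `3`-part in excess on the left is `3^{3d+4} ≤ 4^{3d+4}`, and `31 + d + 27(d+1) + 6d + 8 ≤ 64(d+1)`.
    rw [show PadicW80Par.Ap = (2 : ℝ) ^ 50 from rfl]
    have e33 : (3 : ℝ) ^ (S.d + 2) * 3 = 3 ^ (S.d + 3) := by rw [← pow_succ]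
    have eL : (2 : ℝ) ^ 1 * 3 * 2 ^ 15 * 2 ^ 14 * 2 ^ (S.d + 1) * (2 ^ 12 * 3 ^ (S.d + 2) * 3 * 2 ^ 15) ^ (S.d + 1) =
        2 ^ (31 + S.d + 27 * (S.d + 1)) * (3 ^ (3 * S.d + 4) * 3 ^ ((S.d + 1) * S.d)) := by
      have e1 : (2 : ℝ) ^ 12 * 3 ^ (S.d + 2) * 3 * 2 ^ 15 = 2 ^ 27 * 3 ^ (S.d + 3) := by rw [mul_assoc (2 ^ 12 : ℝ), e33]; ring
      rw [e1, mul_pow, ← pow_mul, ← pow_mul]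
      have e2 : (3 : ℝ) * (3 : ℝ) ^ ((S.d + 3) * (S.d + 1)) = 3 ^ (3 * S.d + 4) * 3 ^ ((S.d + 1) * S.d) := by
        rw [← pow_succ', ← pow_add]; congr 1; ring
      calc (2 : ℝ) ^ 1 * 3 * 2 ^ 15 * 2 ^ 14 * 2 ^ (S.d + 1) * (2 ^ (27 * (S.d + 1)) * 3 ^ ((S.d + 3) * (S.d + 1)))
          = (2 ^ 1 * 2 ^ 15 * 2 ^ 14 * 2 ^ (S.d + 1) * 2 ^ (27 * (S.d + 1))) * (3 * 3 ^ ((S.d + 3) * (S.d + 1))) := by ring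
        _ = 2 ^ (31 + S.d + 27 * (S.d + 1)) * (3 ^ (3 * S.d + 4) * 3 ^ ((S.d + 1) * S.d)) := by
          rw [e2]; simp only [← pow_add]; congr 2; ring
    have eRc : ((2 : ℝ) ^ 50) ^ (S.d + 1) * ((3 : ℝ) ^ (S.d + 1)) ^ S.d * (2 ^ 14) ^ (S.d + 1) =
        2 ^ (64 * (S.d + 1)) * 3 ^ ((S.d + 1) * S.d) := by
      rw [← pow_mul, ← pow_mul, ← pow_mul]
      calc (2 : ℝ) ^ (50 * (S.d + 1)) * 3 ^ ((S.d + 1) * S.d) * 2 ^ (14 * (S.d + 1))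
          = (2 ^ (50 * (S.d + 1)) * 2 ^ (14 * (S.d + 1))) * 3 ^ ((S.d + 1) * S.d) := by ring
        _ = 2 ^ (64 * (S.d + 1)) * 3 ^ ((S.d + 1) * S.d) := by rw [← pow_add]; congr 2; ring
    rw [eL, eRc]
    have h3pow : (3 : ℝ) ^ (3 * S.d + 4) ≤ 2 ^ (2 * (3 * S.d + 4)) := by
      rw [pow_mul]
      exact pow_le_pow_left₀ (by norm_num) (by norm_num) _
    have hd := P.hd
    have hexp : 31 + S.d + 27 * (S.d + 1) + 2 * (3 * S.d + 4) ≤ 64 * (S.d + 1) := by omega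
    have h33 : (0 : ℝ) ≤ 3 ^ ((S.d + 1) * S.d) := by positivity
    calc (2 : ℝ) ^ (31 + S.d + 27 * (S.d + 1)) * (3 ^ (3 * S.d + 4) * 3 ^ ((S.d + 1) * S.d))
        ≤ 2 ^ (31 + S.d + 27 * (S.d + 1)) * (2 ^ (2 * (3 * S.d + 4)) * 3 ^ ((S.d + 1) * S.d)) := by gcongr
      _ = 2 ^ (31 + S.d + 27 * (S.d + 1) + 2 * (3 * S.d + 4)) * 3 ^ ((S.d + 1) * S.d) := by rw [pow_add]; ring
      _ ≤ 2 ^ (64 * (S.d + 1)) * 3 ^ ((S.d + 1) * S.d) :=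
          mul_le_mul_of_nonneg_right (pow_le_pow_right₀ (by norm_num) hexp) h33
  -- (5) combine
  calc (2 : ℝ) * P.Mcl * (P.S₀3 * ((tauSet S.d P.T3).card : ℝ))
      ≤ 2 * P.Mcl * (P.S₀3 * ((2 * (P.T3 : ℝ)) ^ (S.d + 1) / (S.d + 1).factorial)) := by gcongr
    _ ≤ 2 * P.Mcl * (P.S₀3 * ((2 * (P.𝔘3 / (cTp * P.Wstarℓ))) ^ (S.d + 1) / (S.d + 1).factorial)) := by
        gcongr
    _ = A₁ / B₁ := eL
    _ ≤ A₂ / B₂ := heart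
    _ = (P.𝔘3 / (cLp * P.Gℓ)) * (P.Uℓ ^ (S.d + 1) / (D ^ (S.d + 1) * ∏ i, P.Vallℓ i)) := eR.symm
    _ ≤ (P.hparℓ * P.Lb3) * ∏ i, ((P.Lall3 i : ℝ) + 1) := by
        refine mul_le_mul h3 h5 (by positivity) (by positivity)
    _ = P.hparℓ * P.Lb3 * ∏ i, ((P.Lall3 i : ℝ) + 1) := by ring

/-- **The count in `ℕ` without the class price** (`Mcl ≥ 1`; p2-g3's `#box3 L Lθ 0 = h·L_b·∏(Lall3ᵢ+1)` and
`#Pts3 S₀ ≤ S₀` turn it into the Siegel hypothesis `2·#Pts3(S₀)·#tauSet ≤ #box3₀`). [cite: Waldschmidt1980, Lemma 3.2 (pp. 266–267)] -/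
theorem padic_siegel_count3 (S : CW77.Setup) (P : PadicW80ParL S.d) :
    2 * (P.S₀3 * (tauSet S.d P.T3).card) ≤ P.hparℓ * P.Lb3 * ∏ i, (P.Lall3 i + 1) := by
  have key := padic_siegel_count3_real S P
  have hM := P.hMcl
  have h0 : (0 : ℝ) ≤ (P.S₀3 : ℝ) * ((tauSet S.d P.T3).card : ℝ) := by positivity
  have key' : (2 : ℝ) * (P.S₀3 * ((tauSet S.d P.T3).card : ℝ)) ≤ P.hparℓ * P.Lb3 * ∏ i, ((P.Lall3 i : ℝ) + 1) := by
    calc (2 : ℝ) * (P.S₀3 * ((tauSet S.d P.T3).card : ℝ)) = 2 * 1 * (P.S₀3 * ((tauSet S.d P.T3).card : ℝ)) := by ring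
      _ ≤ 2 * P.Mcl * (P.S₀3 * ((tauSet S.d P.T3).card : ℝ)) := by gcongr
      _ ≤ _ := key
  exact_mod_cast key'

end PadicW80ParL

end Summit.ABC.StewartYu

end
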